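import Literature.NumberTheory.Transcendental.HeightLocalGlobal
import Mathlib.NumberTheory.Height.NumberField
import HarnessLib

/-!
# Sharp upper height bound for the fibre forms `T_b = (1 − 2x) + r^{k+2} − b·r·(1 − 2x)` on
# the superelliptic curve `r^e = x(1 − x)`, `e = 2k + 1`

Support lemma for the abc-iut cell's route item GenEllTwo (ledger `stmt-ABC-19679`; [GenEll] =
S. Mochizuki, *Arithmetic elliptic curves in general position*, Math. J. Okayama Univ. **52** (2010),
Thm. 2.1, proof pp. 12–13; cell work package W5 "sharp Prop. 1.6", piece W5d-iv), companion of
`FibreConductorSummation.lean`: the summation theorem there bounds a conductor by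
`Σ_b logHeight₁(τ_b) − logHeight₁(a) + …`, and in the application `τ_b = T_b(P)` is the value of the
integral fibre form `T_b := (t − b)·r·s = s + r^{k+2} − b·r·s` (`s = 1 − 2x`,
`t = 1/r + r^{(e+1)/2}/s`) of the auxiliary function `t` on the curve `D_e : r^e = x(1 − x)`.  The
function `T_b` has a single pole, at the point at infinity, of order `e + 3` in the uniformizer in which
`x` has order `e`, so `h(T_b(P)) = ((e+3)/e)·h(x(P)) + O(1)`; only the UPPER bound is needed (the term
enters with a `+` sign), and the upper bound is elementary and LOCAL:

* at a non-archimedean absolute value `v`:  `v(T_b)^e ≤ max(v b, 1)^e · max(v x, 1)^{e+3}` — from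
  `v(1 − 2x) ≤ max(1, v x)`, `v(r)^e = v(x)·v(1 − x) ≤ max(1, v x)²`, `2(k+2) = e + 3`, and the fact
  that the term `b·r·s` only reaches the exponent `e + 2 ≤ e + 3` (`absValue_fibreForm_pow_le_of_isNonarchimedean`);
* at an archimedean one the same with a constant `C(e) = 3^e·(3^e + 2^{k+2} + 2·3^e)`
  (`absValue_fibreForm_pow_le`);
* hence, by the local-to-global principle (`Literature.NumberTheory.Transcendental.
  mulHeight₁_le_of_forall_absValue_le`) and `H(T^e) = H(T)^e`:
  **`e·logHeight₁ T_b ≤ (e+3)·logHeight₁ x + e·logHeight₁ b + totalWeight K · log C(e)`**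
  (`e_mul_logHeight₁_fibreForm_le`), over any field with an admissible family of absolute values; for
  a number field `totalWeight K = [K:ℚ]`, so in absolute heights the constant is uniform in `K`
  (`e_mul_absLogHeight_fibreForm_le`).

Classical (Weil-height bookkeeping, cf. Bombieri–Gubler, *Heights in Diophantine Geometry*, §1.5
[cite: BombieriGubler2006, §1.5]); no definitions beyond the abbreviation-free statements; nothing here
refers to the disputed parts of the abc-iut corpus. [cite: MochizukiGenEll2010, Thm 2.1 proof pp.12-13]
-/

noncomputable section

open Height Height.AdmissibleAbsValues Finset Real
open Literature.NumberTheory.Transcendental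

namespace Literature.NumberTheory.DiophantineGeometry.FibreConductor

variable {K : Type*} [Field K]

/-! ## Local estimates -/

section Local

variable (v : AbsoluteValue K ℝ) {k : ℕ} {x r b : K}

omit v in
/-- Ultrametric inequality for a difference (plumbing). [folklore] -/
private theorem nonarch_sub_le {v : AbsoluteValue K ℝ} (hv : IsNonarchimedean v) (a c : K) :
    v (a - c) ≤ max (v a) (v c) := by
  rw [sub_eq_add_neg]
  have h := hv a (-c)
  rwa [AbsoluteValue.map_neg] at h

/-- `v 2 ≤ 2` for any absolute value (plumbing). [folklore] -/
private theorem abv_two_le : v (2 : K) ≤ 2 := by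
  calc v (2 : K) = v (1 + 1) := by norm_num
    _ ≤ v 1 + v 1 := v.add_le _ _
    _ = 2 := by rw [map_one]; norm_num

/-- Non-archimedean local bound for the fibre form: if `r^{2k+1} = x(1−x)` then
`v((1−2x) + r^{k+2} − b·r·(1−2x))^{2k+1} ≤ max(v b, 1)^{2k+1} · max(v x, 1)^{2k+4}` (no constant).
[cite: MochizukiGenEll2010, Thm 2.1 proof pp.12-13] -/
theorem absValue_fibreForm_pow_le_of_isNonarchimedean {v : AbsoluteValue K ℝ} (hv : IsNonarchimedean v)
    (hxr : r ^ (2 * k + 1) = x * (1 - x)) :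
    v ((1 - 2 * x) + r ^ (k + 2) - b * r * (1 - 2 * x)) ^ (2 * k + 1) ≤
      max (v b) 1 ^ (2 * k + 1) * max (v x) 1 ^ (2 * k + 4) := by
  set M : ℝ := max (v x) 1 with hM
  set B : ℝ := max (v b) 1 with hB
  have hM1 : 1 ≤ M := le_max_right _ _
  have hB1 : 1 ≤ B := le_max_right _ _
  have hM0 : 0 ≤ M := zero_le_one.trans hM1
  have hB0 : 0 ≤ B := zero_le_one.trans hB1
  -- the three pieces
  have h2 : v 2 ≤ 1 := by
    have h := IsNonarchimedean.apply_natCast_le_one hv (n := 2)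
    exact_mod_cast h
  have hs : v (1 - 2 * x) ≤ M := by
    calc v (1 - 2 * x) ≤ max (v 1) (v (2 * x)) := nonarch_sub_le hv _ _
      _ ≤ M := by
          rw [map_one, map_mul]
          refine max_le hM1 ?_
          calc v 2 * v x ≤ 1 * M := mul_le_mul h2 (le_max_left _ _) (v.nonneg _) zero_le_one
            _ = M := one_mul M
  have h1x : v (1 - x) ≤ M := by
    calc v (1 - x) ≤ max (v 1) (v x) := nonarch_sub_le hv _ _
      _ ≤ M := by rw [map_one]; exact max_le hM1 (le_max_left _ _)
  have hre : v r ^ (2 * k + 1) ≤ M ^ 2 := by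
    rw [← map_pow, hxr, map_mul, pow_two]
    exact mul_le_mul (le_max_left _ _) h1x (v.nonneg _) hM0
  -- `v r ^ (e(k+2)) ≤ M^{e+3}`
  have hrk : (v r ^ (k + 2)) ^ (2 * k + 1) ≤ M ^ (2 * k + 4) := by
    rw [← pow_mul, mul_comm (k + 2), pow_mul]
    calc (v r ^ (2 * k + 1)) ^ (k + 2) ≤ (M ^ 2) ^ (k + 2) :=
          pow_le_pow_left₀ (pow_nonneg (v.nonneg _) _) hre _
      _ = M ^ (2 * k + 4) := by rw [← pow_mul]; ring_nf
  -- `v(b r s)^e ≤ B^e M^{e+2} ≤ B^e M^{e+3}`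
  have hbrs : (v (b * r * (1 - 2 * x))) ^ (2 * k + 1) ≤ B ^ (2 * k + 1) * M ^ (2 * k + 4) := by
    rw [map_mul, map_mul, mul_pow, mul_pow]
    have hb' : v b ^ (2 * k + 1) ≤ B ^ (2 * k + 1) := pow_le_pow_left₀ (v.nonneg _) (le_max_left _ _) _
    have hs' : v (1 - 2 * x) ^ (2 * k + 1) ≤ M ^ (2 * k + 1) := pow_le_pow_left₀ (v.nonneg _) hs _
    calc v b ^ (2 * k + 1) * v r ^ (2 * k + 1) * v (1 - 2 * x) ^ (2 * k + 1)
        ≤ B ^ (2 * k + 1) * M ^ 2 * M ^ (2 * k + 1) := by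
          gcongr
      _ = B ^ (2 * k + 1) * M ^ (2 * k + 3) := by ring
      _ ≤ B ^ (2 * k + 1) * M ^ (2 * k + 4) :=
          mul_le_mul_of_nonneg_left (pow_le_pow_right₀ hM1 (by omega)) (by positivity)
  have hsM : v (1 - 2 * x) ^ (2 * k + 1) ≤ B ^ (2 * k + 1) * M ^ (2 * k + 4) := by
    calc v (1 - 2 * x) ^ (2 * k + 1) ≤ M ^ (2 * k + 1) := pow_le_pow_left₀ (v.nonneg _) hs _
      _ ≤ M ^ (2 * k + 4) := pow_le_pow_right₀ hM1 (by omega)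
      _ ≤ B ^ (2 * k + 1) * M ^ (2 * k + 4) := le_mul_of_one_le_left (by positivity) (one_le_pow₀ hB1)
  have hrM : (v r ^ (k + 2)) ^ (2 * k + 1) ≤ B ^ (2 * k + 1) * M ^ (2 * k + 4) :=
    hrk.trans (le_mul_of_one_le_left (by positivity) (one_le_pow₀ hB1))
  -- ultrametric: `v(T) ≤ max (max (v s) (v r^{k+2})) (v (b r s))`
  have hT : v ((1 - 2 * x) + r ^ (k + 2) - b * r * (1 - 2 * x)) ≤
      max (max (v (1 - 2 * x)) (v r ^ (k + 2))) (v (b * r * (1 - 2 * x))) := by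
    calc v ((1 - 2 * x) + r ^ (k + 2) - b * r * (1 - 2 * x))
        ≤ max (v ((1 - 2 * x) + r ^ (k + 2))) (v (b * r * (1 - 2 * x))) := nonarch_sub_le hv _ _
      _ ≤ max (max (v (1 - 2 * x)) (v (r ^ (k + 2)))) (v (b * r * (1 - 2 * x))) :=
          max_le_max (hv _ _) le_rfl
      _ = _ := by rw [map_pow]
  calc v ((1 - 2 * x) + r ^ (k + 2) - b * r * (1 - 2 * x)) ^ (2 * k + 1)
      ≤ (max (max (v (1 - 2 * x)) (v r ^ (k + 2))) (v (b * r * (1 - 2 * x)))) ^ (2 * k + 1) :=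
        pow_le_pow_left₀ (v.nonneg _) hT _
    _ ≤ B ^ (2 * k + 1) * M ^ (2 * k + 4) := by
        rcases le_total (max (v (1 - 2 * x)) (v r ^ (k + 2))) (v (b * r * (1 - 2 * x))) with h | h
        · rw [max_eq_right h]; exact hbrs
        · rw [max_eq_left h]
          rcases le_total (v (1 - 2 * x)) (v r ^ (k + 2)) with h' | h'
          · rw [max_eq_right h']; exact hrM
          · rw [max_eq_left h']; exact hsM

/-- The archimedean constant `C(k) := 3^{2k+1}·(3^{2k+1} + 2^{k+2} + 2·3^{2k+1})` (any larger number
works). [cite: MochizukiGenEll2010, Thm 2.1 proof pp.12-13] -/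
theorem one_le_fibreFormConst (k : ℕ) :
    (1 : ℝ) ≤ (3 : ℝ) ^ (2 * k + 1) * ((3 : ℝ) ^ (2 * k + 1) + 2 ^ (k + 2) + 2 * 3 ^ (2 * k + 1)) := by
  have h3 : (1 : ℝ) ≤ (3 : ℝ) ^ (2 * k + 1) := one_le_pow₀ (by norm_num)
  have h2 : (0 : ℝ) ≤ (2 : ℝ) ^ (k + 2) := by positivity
  nlinarith

/-- General (archimedean-type) local bound for the fibre form: for ANY absolute value `v`, if
`r^{2k+1} = x(1−x)` then
`v(T_b)^{2k+1} ≤ C(k) · max(v b, 1)^{2k+1} · max(v x, 1)^{2k+4}` with the constant of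
`one_le_fibreFormConst`. [cite: MochizukiGenEll2010, Thm 2.1 proof pp.12-13] -/
theorem absValue_fibreForm_pow_le (hxr : r ^ (2 * k + 1) = x * (1 - x)) :
    v ((1 - 2 * x) + r ^ (k + 2) - b * r * (1 - 2 * x)) ^ (2 * k + 1) ≤
      ((3 : ℝ) ^ (2 * k + 1) * ((3 : ℝ) ^ (2 * k + 1) + 2 ^ (k + 2) + 2 * 3 ^ (2 * k + 1))) *
        (max (v b) 1 ^ (2 * k + 1) * max (v x) 1 ^ (2 * k + 4)) := by
  set M : ℝ := max (v x) 1 with hM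
  set B : ℝ := max (v b) 1 with hB
  have hM1 : 1 ≤ M := le_max_right _ _
  have hB1 : 1 ≤ B := le_max_right _ _
  have hM0 : 0 ≤ M := zero_le_one.trans hM1
  have hB0 : 0 ≤ B := zero_le_one.trans hB1
  have hvx : v x ≤ M := le_max_left _ _
  -- pieces
  have hs : v (1 - 2 * x) ≤ 3 * M := by
    calc v (1 - 2 * x) ≤ v 1 + v (2 * x) := v.sub_le_add _ _
      _ = 1 + v 2 * v x := by rw [map_one, map_mul]
      _ ≤ M + 2 * M := by
          have h2 : v 2 ≤ 2 := abv_two_le v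
          nlinarith [v.nonneg x, v.nonneg (2 : K)]
      _ = 3 * M := by ring
  have h1x : v (1 - x) ≤ 2 * M := by
    calc v (1 - x) ≤ v 1 + v x := v.sub_le_add _ _
      _ ≤ M + M := by rw [map_one]; exact add_le_add hM1 hvx
      _ = 2 * M := by ring
  have hre : v r ^ (2 * k + 1) ≤ 2 * M ^ 2 := by
    rw [← map_pow, hxr, map_mul]
    calc v x * v (1 - x) ≤ M * (2 * M) := mul_le_mul hvx h1x (v.nonneg _) hM0
      _ = 2 * M ^ 2 := by ring
  have hrk : (v r ^ (k + 2)) ^ (2 * k + 1) ≤ 2 ^ (k + 2) * M ^ (2 * k + 4) := by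
    rw [← pow_mul, mul_comm (k + 2), pow_mul]
    calc (v r ^ (2 * k + 1)) ^ (k + 2) ≤ (2 * M ^ 2) ^ (k + 2) :=
          pow_le_pow_left₀ (pow_nonneg (v.nonneg _) _) hre _
      _ = 2 ^ (k + 2) * M ^ (2 * k + 4) := by rw [mul_pow, ← pow_mul]; ring_nf
  have hsE : v (1 - 2 * x) ^ (2 * k + 1) ≤ 3 ^ (2 * k + 1) * M ^ (2 * k + 4) := by
    calc v (1 - 2 * x) ^ (2 * k + 1) ≤ (3 * M) ^ (2 * k + 1) := pow_le_pow_left₀ (v.nonneg _) hs _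
      _ = 3 ^ (2 * k + 1) * M ^ (2 * k + 1) := mul_pow _ _ _
      _ ≤ 3 ^ (2 * k + 1) * M ^ (2 * k + 4) :=
          mul_le_mul_of_nonneg_left (pow_le_pow_right₀ hM1 (by omega)) (by positivity)
  have hbrs : (v (b * r * (1 - 2 * x))) ^ (2 * k + 1) ≤
      2 * 3 ^ (2 * k + 1) * (B ^ (2 * k + 1) * M ^ (2 * k + 4)) := by
    rw [map_mul, map_mul, mul_pow, mul_pow]
    have hb' : v b ^ (2 * k + 1) ≤ B ^ (2 * k + 1) := pow_le_pow_left₀ (v.nonneg _) (le_max_left _ _) _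
    have hs' : v (1 - 2 * x) ^ (2 * k + 1) ≤ 3 ^ (2 * k + 1) * M ^ (2 * k + 1) := by
      calc v (1 - 2 * x) ^ (2 * k + 1) ≤ (3 * M) ^ (2 * k + 1) := pow_le_pow_left₀ (v.nonneg _) hs _
        _ = _ := mul_pow _ _ _
    calc v b ^ (2 * k + 1) * v r ^ (2 * k + 1) * v (1 - 2 * x) ^ (2 * k + 1)
        ≤ B ^ (2 * k + 1) * (2 * M ^ 2) * (3 ^ (2 * k + 1) * M ^ (2 * k + 1)) := by gcongr
      _ = 2 * 3 ^ (2 * k + 1) * (B ^ (2 * k + 1) * M ^ (2 * k + 3)) := by ring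
      _ ≤ 2 * 3 ^ (2 * k + 1) * (B ^ (2 * k + 1) * M ^ (2 * k + 4)) :=
          mul_le_mul_of_nonneg_left
            (mul_le_mul_of_nonneg_left (pow_le_pow_right₀ hM1 (by omega)) (by positivity))
            (by positivity)
  -- triangle inequality: `v(T) ≤ v s + v r^{k+2} + v (b r s) ≤ 3 · max`
  set A₁ := v (1 - 2 * x) with hA₁
  set A₂ := v r ^ (k + 2) with hA₂
  set A₃ := v (b * r * (1 - 2 * x)) with hA₃
  have hA₁0 : 0 ≤ A₁ := v.nonneg _
  have hA₂0 : 0 ≤ A₂ := pow_nonneg (v.nonneg _) _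
  have hA₃0 : 0 ≤ A₃ := v.nonneg _
  set Amax := max (max A₁ A₂) A₃ with hAmax
  have hT : v ((1 - 2 * x) + r ^ (k + 2) - b * r * (1 - 2 * x)) ≤ 3 * Amax := by
    calc v ((1 - 2 * x) + r ^ (k + 2) - b * r * (1 - 2 * x))
        ≤ v ((1 - 2 * x) + r ^ (k + 2)) + v (b * r * (1 - 2 * x)) := v.sub_le_add _ _
      _ ≤ (A₁ + A₂) + A₃ := by
          rw [hA₂, ← map_pow]
          exact add_le_add (v.add_le _ _) le_rfl
      _ ≤ Amax + Amax + Amax :=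
          add_le_add (add_le_add ((le_max_left _ _).trans (le_max_left _ _))
            ((le_max_right _ _).trans (le_max_left _ _))) (le_max_right _ _)
      _ = 3 * Amax := by ring
  have hAmaxE : Amax ^ (2 * k + 1) ≤
      ((3 : ℝ) ^ (2 * k + 1) + 2 ^ (k + 2) + 2 * 3 ^ (2 * k + 1)) *
        (B ^ (2 * k + 1) * M ^ (2 * k + 4)) := by
    have hX : 0 ≤ B ^ (2 * k + 1) * M ^ (2 * k + 4) := by positivity
    -- each of the three candidates is bounded by its own constant times `X`, all ≤ the sum
    have c1 : A₁ ^ (2 * k + 1) ≤ ((3 : ℝ) ^ (2 * k + 1) + 2 ^ (k + 2) + 2 * 3 ^ (2 * k + 1)) *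
        (B ^ (2 * k + 1) * M ^ (2 * k + 4)) := by
      calc A₁ ^ (2 * k + 1) ≤ 3 ^ (2 * k + 1) * M ^ (2 * k + 4) := hsE
        _ ≤ 3 ^ (2 * k + 1) * (B ^ (2 * k + 1) * M ^ (2 * k + 4)) := by
            gcongr; exact le_mul_of_one_le_left (by positivity) (one_le_pow₀ hB1)
        _ ≤ _ := by gcongr; nlinarith [pow_nonneg (show (0:ℝ) ≤ 2 by norm_num) (k + 2),
                      pow_nonneg (show (0:ℝ) ≤ 3 by norm_num) (2 * k + 1)]
    have c2 : A₂ ^ (2 * k + 1) ≤ ((3 : ℝ) ^ (2 * k + 1) + 2 ^ (k + 2) + 2 * 3 ^ (2 * k + 1)) *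
        (B ^ (2 * k + 1) * M ^ (2 * k + 4)) := by
      calc A₂ ^ (2 * k + 1) ≤ 2 ^ (k + 2) * M ^ (2 * k + 4) := hrk
        _ ≤ 2 ^ (k + 2) * (B ^ (2 * k + 1) * M ^ (2 * k + 4)) := by
            gcongr; exact le_mul_of_one_le_left (by positivity) (one_le_pow₀ hB1)
        _ ≤ _ := by gcongr; nlinarith [pow_nonneg (show (0:ℝ) ≤ 3 by norm_num) (2 * k + 1)]
    have c3 : A₃ ^ (2 * k + 1) ≤ ((3 : ℝ) ^ (2 * k + 1) + 2 ^ (k + 2) + 2 * 3 ^ (2 * k + 1)) *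
        (B ^ (2 * k + 1) * M ^ (2 * k + 4)) := by
      calc A₃ ^ (2 * k + 1) ≤ 2 * 3 ^ (2 * k + 1) * (B ^ (2 * k + 1) * M ^ (2 * k + 4)) := hbrs
        _ ≤ _ := by gcongr; nlinarith [pow_nonneg (show (0:ℝ) ≤ 2 by norm_num) (k + 2),
                      pow_nonneg (show (0:ℝ) ≤ 3 by norm_num) (2 * k + 1)]
    rcases le_total (max A₁ A₂) A₃ with h | h
    · rw [hAmax, max_eq_right h]; exact c3
    · rw [hAmax, max_eq_left h]
      rcases le_total A₁ A₂ with h' | h'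
      · rw [max_eq_right h']; exact c2
      · rw [max_eq_left h']; exact c1
  have hAmax0 : 0 ≤ Amax := hA₃0.trans (le_max_right _ _)
  calc v ((1 - 2 * x) + r ^ (k + 2) - b * r * (1 - 2 * x)) ^ (2 * k + 1)
      ≤ (3 * Amax) ^ (2 * k + 1) := pow_le_pow_left₀ (v.nonneg _) hT _
    _ = 3 ^ (2 * k + 1) * Amax ^ (2 * k + 1) := mul_pow _ _ _
    _ ≤ 3 ^ (2 * k + 1) * (((3 : ℝ) ^ (2 * k + 1) + 2 ^ (k + 2) + 2 * 3 ^ (2 * k + 1)) *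
          (B ^ (2 * k + 1) * M ^ (2 * k + 4))) := by gcongr
    _ = _ := by ring

end Local

/-! ## Global bound -/

variable [AdmissibleAbsValues K]

/-- **Sharp upper height bound for the fibre form.**  For `r^{2k+1} = x(1−x)` in a field with an
admissible family of absolute values and any `b`:
`(2k+1)·logHeight₁((1−2x) + r^{k+2} − b·r·(1−2x)) ≤ (2k+4)·logHeight₁ x + (2k+1)·logHeight₁ b
  + totalWeight K · log C(k)` — i.e. `e·h(T_b) ≤ (e+3)·h(x) + e·h(b) + O([K:ℚ])`, the slope `(e+3)/e`
being the pole order of `T_b` at the point at infinity of the curve divided by that of `x`.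
[cite: MochizukiGenEll2010, Thm 2.1 proof pp.12-13] -/
theorem e_mul_logHeight₁_fibreForm_le {k : ℕ} {x r : K} (hxr : r ^ (2 * k + 1) = x * (1 - x)) (b : K) :
    (2 * k + 1 : ℝ) * logHeight₁ ((1 - 2 * x) + r ^ (k + 2) - b * r * (1 - 2 * x)) ≤
      (2 * k + 4 : ℝ) * logHeight₁ x + (2 * k + 1 : ℝ) * logHeight₁ b +
        totalWeight K * Real.log ((3 : ℝ) ^ (2 * k + 1) *
          ((3 : ℝ) ^ (2 * k + 1) + 2 ^ (k + 2) + 2 * 3 ^ (2 * k + 1))) := by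
  set T := (1 - 2 * x) + r ^ (k + 2) - b * r * (1 - 2 * x) with hT
  set C : ℝ := (3 : ℝ) ^ (2 * k + 1) * ((3 : ℝ) ^ (2 * k + 1) + 2 ^ (k + 2) + 2 * 3 ^ (2 * k + 1))
    with hC
  have hC1 : 1 ≤ C := one_le_fibreFormConst k
  -- local-to-global on `y := T^e` with the two variables `b` (exponent `e`) and `x` (exponent `e+3`)
  have key : mulHeight₁ (T ^ (2 * k + 1)) ≤
      C ^ totalWeight K * ∏ i ∈ (Finset.univ : Finset Bool),
        mulHeight₁ ((fun j : Bool => if j then b else x) i) ^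
          ((fun j : Bool => if j then 2 * k + 1 else 2 * k + 4) i) := by
    refine mulHeight₁_le_of_forall_absValue_le Finset.univ hC1 (fun v _ => ?_) (fun v hv => ?_)
    · rw [map_pow, Fintype.prod_bool]
      simpa using absValue_fibreForm_pow_le v (b := b) hxr
    · rw [map_pow, Fintype.prod_bool]
      simpa using absValue_fibreForm_pow_le_of_isNonarchimedean (isNonarchimedean v hv) (b := b) hxr
  rw [Fintype.prod_bool] at key
  simp only [ite_true, ite_false, Bool.false_eq_true] at key
  -- take logarithms
  have hTpos : 0 < mulHeight₁ (T ^ (2 * k + 1)) := mulHeight₁_pos _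
  have hb : 0 < mulHeight₁ b := mulHeight₁_pos _
  have hx : 0 < mulHeight₁ x := mulHeight₁_pos _
  have hCpos : 0 < C := zero_lt_one.trans_le hC1
  have hlog := Real.log_le_log hTpos key
  rw [mulHeight₁_pow, Real.log_pow, Real.log_mul (by positivity) (by positivity),
    Real.log_mul (by positivity) (by positivity), Real.log_pow, Real.log_pow, Real.log_pow] at hlog
  simp only [logHeight₁_eq_log_mulHeight₁]
  push_cast at hlog ⊢
  linarith

/-- Number-field form in absolute heights `h := logHeight₁/[K:ℚ]`: the constant is uniform in `K`:
`e·h(T_b) ≤ (e+3)·h(x) + e·h(b) + log C(k)`. [cite: MochizukiGenEll2010, Thm 2.1 proof pp.12-13] -/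
theorem e_mul_absLogHeight_fibreForm_le {K : Type*} [Field K] [NumberField K] {k : ℕ} {x r : K}
    (hxr : r ^ (2 * k + 1) = x * (1 - x)) (b : K) :
    (2 * k + 1 : ℝ) * ((Module.finrank ℚ K : ℝ)⁻¹ *
        logHeight₁ ((1 - 2 * x) + r ^ (k + 2) - b * r * (1 - 2 * x))) ≤
      (2 * k + 4 : ℝ) * ((Module.finrank ℚ K : ℝ)⁻¹ * logHeight₁ x) +
        (2 * k + 1 : ℝ) * ((Module.finrank ℚ K : ℝ)⁻¹ * logHeight₁ b) +
        Real.log ((3 : ℝ) ^ (2 * k + 1) * ((3 : ℝ) ^ (2 * k + 1) + 2 ^ (k + 2) + 2 * 3 ^ (2 * k + 1))) := by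
  have h := e_mul_logHeight₁_fibreForm_le (K := K) hxr b
  rw [NumberField.totalWeight_eq_finrank] at h
  set n : ℝ := (Module.finrank ℚ K : ℝ) with hn
  have hnpos : (0 : ℝ) < n := by rw [hn]; exact_mod_cast Module.finrank_pos
  have h' := mul_le_mul_of_nonneg_left h (inv_nonneg.mpr hnpos.le)
  have hc : n⁻¹ * (n * Real.log ((3 : ℝ) ^ (2 * k + 1) *
      ((3 : ℝ) ^ (2 * k + 1) + 2 ^ (k + 2) + 2 * 3 ^ (2 * k + 1)))) =
      Real.log ((3 : ℝ) ^ (2 * k + 1) * ((3 : ℝ) ^ (2 * k + 1) + 2 ^ (k + 2) + 2 * 3 ^ (2 * k + 1))) := by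
    rw [← mul_assoc, inv_mul_cancel₀ hnpos.ne', one_mul]
  rw [mul_add, mul_add, hc] at h'
  linarith

end Literature.NumberTheory.DiophantineGeometry.FibreConductor
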